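import Mathlib.Geometry.Manifold.Diffeomorph
import Mathlib.Geometry.Manifold.Instances.Real
import Mathlib.Topology.Homotopy.Contractible
import Mathlib.Topology.Homeomorph.Defs
import Literature.Topology.FourManifolds.Cobordism
import HarnessLib

/-!
# Corks (Akbulut)

Topic: `Literature/Topology/FourManifolds`. Definition request `defn-IsCork` (route
`SmoothPoincare4/Stabilisation`: cork refinement of stabilisation results, and the cork theorem).

## Content

For a smooth `4`-manifold with boundary `C` (model `𝓡∂ 4`), a boundary datum
`b : BoundaryData (𝓡∂ 4) C (𝓡 3)` (the smooth `3`-manifold `∂C` with its embedding `b.incl`,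
`Cobordism.lean`) and a self-diffeomorphism `τ` of `∂C = b.carrier`:

* `ExtendsToHomeomorph b τ` / `ExtendsToDiffeomorph b τ`: `τ` is the restriction to `∂C` of a
  self-homeomorphism / self-diffeomorphism of `C`.
* `IsLooseCork b τ`: `C` is compact, Hausdorff and contractible, and `τ` is an involution of `∂C`
  extending to a self-homeomorphism of `C` (the definition of some authors, who drop the
  non-extension clause; requested as a separate predicate).
* `IsCork b τ`: additionally `τ` extends to **no** self-diffeomorphism of `C` — Akbulut's
  definition (Akbulut 2016, Def. 10.1; Akbulut–Yasui 2008, Def. 1.1; Gompf–Stipsicz 1999, §9.3).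

## Sources

* S. Akbulut, *4-Manifolds*, Oxford Graduate Texts in Mathematics 25, OUP 2016, Def. 10.1.
* S. Akbulut, K. Yasui, *Corks, plugs and exotic structures*, J. Gökova Geom. Topol. 2 (2008),
  40–82, Def. 1.1.
* R. Gompf, A. Stipsicz, *4-Manifolds and Kirby Calculus*, GSM 20, AMS 1999, §9.3.
* C. Curtis, M. Freedman, W.-C. Hsiang, R. Stong, Invent. Math. 123 (1996) 343–348;
  R. Matveyev, J. Differential Geom. 44 (1996) 571–582 (the cork theorem).

## Design choices and wording risks

* **Stein is omitted.** Akbulut (2016, Def. 10.1) and Akbulut–Yasui (2008, Def. 1.1) require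
  `C` to be a compact contractible *Stein* manifold; much of the later literature (and
  Gompf–Stipsicz §9.3's discussion of the Akbulut cork) uses "compact contractible smooth" only.
  Mathlib has no Stein manifolds; the requester asked for the smooth notion. A Stein refinement
  would be an extra conjunct.
* The boundary is Rothgang-style *data* (`BoundaryData`), as everywhere in `Cobordism.lean`;
  `τ` is a `Diffeomorph` of `b.carrier` (a smooth involution), and "extends" means: some
  self-map of `C` restricts, along `b.incl`, to `τ`.
* By Freedman's theorem every self-diffeomorphism of the boundary (an integral homology sphere)
  of a compact contractible `4`-manifold extends to a self-homeomorphism, so the homeomorphism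
  clause of `IsLooseCork` is redundant in truth but is part of the printed definition; it is kept.
* Hygiene: `CompactSpace C ∧ T2Space C` are conjuncts (a "compact manifold" is Hausdorff);
  smoothness `IsManifold (𝓡∂ 4) ∞ C` is an instance hypothesis of the predicates.
-/

open scoped Manifold ContDiff Topology
open Set Function

noncomputable section

namespace Literature.Topology.FourManifolds

universe u

variable {C : Type u} [TopologicalSpace C] [ChartedSpace (EuclideanHalfSpace 4) C]

/-- `τ : ∂C ≃ ∂C` extends to a self-homeomorphism of `C`: there is `h : C ≃ₜ C` with
`h ∘ incl = incl ∘ τ` on the boundary datum `b` (Akbulut 2016, Def. 10.1).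
[cite: Akbulut2016, Def. 10.1] -/
def ExtendsToHomeomorph (b : BoundaryData (𝓡∂ 4) C (𝓡 3))
    (τ : b.carrier ≃ₘ⟮𝓡 3, 𝓡 3⟯ b.carrier) : Prop :=
  ∃ h : C ≃ₜ C, ∀ x : b.carrier, h (b.incl x) = b.incl (τ x)

/-- `τ : ∂C ≃ ∂C` extends to a self-diffeomorphism of `C`: there is `g : C ≃ₘ C` (model `𝓡∂ 4`)
with `g ∘ incl = incl ∘ τ` (Akbulut 2016, Def. 10.1). [cite: Akbulut2016, Def. 10.1] -/
def ExtendsToDiffeomorph [IsManifold (𝓡∂ 4) ∞ C] (b : BoundaryData (𝓡∂ 4) C (𝓡 3))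
    (τ : b.carrier ≃ₘ⟮𝓡 3, 𝓡 3⟯ b.carrier) : Prop :=
  ∃ g : C ≃ₘ⟮𝓡∂ 4, 𝓡∂ 4⟯ C, ∀ x : b.carrier, g (b.incl x) = b.incl (τ x)

/-- **Loose cork**: `C` is a compact (Hausdorff) contractible smooth `4`-manifold with boundary
`∂C = b`, and `τ` is a smooth involution of `∂C` that extends to a self-homeomorphism of `C` — the
cork condition *without* the non-extension-to-a-diffeomorphism clause (as used by authors who
drop it; cf. Gompf–Stipsicz 1999, §9.3). [cite: GompfStipsicz1999, §9.3] -/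
def IsLooseCork [IsManifold (𝓡∂ 4) ∞ C] (b : BoundaryData (𝓡∂ 4) C (𝓡 3))
    (τ : b.carrier ≃ₘ⟮𝓡 3, 𝓡 3⟯ b.carrier) : Prop :=
  CompactSpace C ∧ T2Space C ∧ ContractibleSpace C ∧ Function.Involutive τ ∧
    ExtendsToHomeomorph b τ

/-- **Cork** (Akbulut): a compact contractible smooth `4`-manifold `C` with boundary `∂C = b`
together with a smooth involution `τ : ∂C → ∂C` that extends to a self-homeomorphism of `C` but
to **no** self-diffeomorphism of `C` (Akbulut 2016, Def. 10.1; Akbulut–Yasui 2008, Def. 1.1;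
the Stein condition of loc. cit. is omitted, see the module docstring).
[cite: Akbulut2016, Def. 10.1] -/
def IsCork [IsManifold (𝓡∂ 4) ∞ C] (b : BoundaryData (𝓡∂ 4) C (𝓡 3))
    (τ : b.carrier ≃ₘ⟮𝓡 3, 𝓡 3⟯ b.carrier) : Prop :=
  IsLooseCork b τ ∧ ¬ ExtendsToDiffeomorph b τ

/-! ### API -/

section API

variable [IsManifold (𝓡∂ 4) ∞ C] {b : BoundaryData (𝓡∂ 4) C (𝓡 3)}
  {τ : b.carrier ≃ₘ⟮𝓡 3, 𝓡 3⟯ b.carrier}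

/-- A cork is a loose cork. [cite: Akbulut2016, Def. 10.1] -/
theorem IsCork.isLooseCork (h : IsCork b τ) : IsLooseCork b τ := h.1

/-- The boundary involution of a cork extends to no self-diffeomorphism.
[cite: Akbulut2016, Def. 10.1] -/
theorem IsCork.not_extendsToDiffeomorph (h : IsCork b τ) : ¬ ExtendsToDiffeomorph b τ := h.2

/-- A diffeomorphic extension is in particular a homeomorphic extension. [folklore] -/
theorem ExtendsToDiffeomorph.extendsToHomeomorph (h : ExtendsToDiffeomorph b τ) :
    ExtendsToHomeomorph b τ := by
  obtain ⟨g, hg⟩ := h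
  exact ⟨g.toHomeomorph, hg⟩

/-- The identity of `∂C` extends to a diffeomorphism (the identity of `C`); hence `(C, id)` is
never a cork. [folklore] -/
theorem extendsToDiffeomorph_refl (b : BoundaryData (𝓡∂ 4) C (𝓡 3)) :
    ExtendsToDiffeomorph b (Diffeomorph.refl (𝓡 3) b.carrier ∞) :=
  ⟨Diffeomorph.refl _ C _, fun _ => rfl⟩

/-- `(C, id_{∂C})` is not a cork. [folklore] -/
theorem not_isCork_refl (b : BoundaryData (𝓡∂ 4) C (𝓡 3)) :
    ¬ IsCork b (Diffeomorph.refl (𝓡 3) b.carrier ∞) :=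
  fun h => h.2 (extendsToDiffeomorph_refl b)

/-- The cork involution is a genuine involution: `τ (τ x) = x`. [cite: Akbulut2016, Def. 10.1] -/
theorem IsLooseCork.involutive (h : IsLooseCork b τ) : Function.Involutive τ := h.2.2.2.1

/-- A (loose) cork is compact. [cite: Akbulut2016, Def. 10.1] -/
theorem IsLooseCork.compactSpace (h : IsLooseCork b τ) : CompactSpace C := h.1

/-- A (loose) cork is contractible. [cite: Akbulut2016, Def. 10.1] -/
theorem IsLooseCork.contractibleSpace (h : IsLooseCork b τ) : ContractibleSpace C := h.2.2.1

end API

end Literature.Topology.FourManifolds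

end
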